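import Literature.NumberTheory.LFunctions.YoshidaWindowSpaces
import Literature.NumberTheory.LFunctions.WeilMarkovQuadratic
import HarnessLib

/-!
# Format C, entry theorem (L-C1) — I: Yoshida's window basis `χ_n`, its elementary integrals, `‖Σ c_n χ_n‖²`

Helper file of the rh-explicit Weil-positivity programme (`--supports stmt-RiemannHypothesis-0098`; seat
rh-explicit-weil-2), RH-free, Mathlib + landed tree files only, no definitions, no named facts.

The format-C certificate chain (weil-10 FORMATC-DESIGN §1; weil-3 L-C4 dictionary
`weilPositivityOn_of_weilWindowForm_sum_chi_nonneg`) evaluates the window form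
`weilWindowForm a u = P(u) + 𝓔_a(u) − M_a‖u‖²` (`Literature/…/WeilWindowForm.lean`) on trigonometric windows
`u = Σ_{n ∈ s} c_n χ_n`, `χ_n(x) = (2a)^{-1/2} e^{πinx/a}·1_{[-a,a]}(x)` (`Yoshida1992.chi`, Yoshida 1992 §3 p. 289),
and needs every piece as an explicit Hermitian form `Σ_n Σ_m Re(conj c_n · c_m) G(n,m)` with REAL closed-form
entries — Yoshida's "matrix coefficients" of §5 (pp. 297–302, (5.1)–(5.16)).  This file is the common toolkit:

* evaluation / truncation lemmas for `χ_n`, integrability of `χ_n φ`, and the reduction of `∫_ℝ χ_n φ` to a window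
  integral `∫_{-a}^{a}`;
* the window integral `∫_{-a}^{a} e^{(πin/a + c)x} dx = (−1)^n (e^{ca} − e^{−ca})/(πin/a + c)` (endpoint values
  `e^{±πin} = (−1)^n`) and `∫_ℝ χ_n e^{cx}` for real `c ≠ 0`;
* orthonormality `∫_ℝ χ_n conj(χ_m) = δ_{nm}` (from lit-1's `Yoshida1992.fourierCoeff_chi`) and
  **`‖Σ c_n χ_n‖₂² = Σ |c_n|²`**, also in the sesquilinear shape `Σ_n Σ_m Re(conj c_n c_m) δ_{nm}`;
* the bookkeeping identity `‖Σ c_n r_n‖² = Σ_n Σ_m Re(conj c_n · c_m) r_n r_m` for REAL `r_n` and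
  `∫_ℝ (Σ c_n χ_n) φ = Σ c_n ∫_ℝ χ_n φ`.

The pole form (Yoshida (5.1)) is in `WeilFormatCEntryPole.lean`; increments / prime block and the archimedean block
follow in sibling files.

References: H. Yoshida, *On Hermitian forms attached to zeta functions*, Adv. Stud. Pure Math. 21 (1992) 281–325,
§3 p. 289, §5 pp. 297–302 [Yoshida1992HermitianForms].
-/

set_option linter.dupNamespace false

noncomputable section

open Complex Set MeasureTheory Finset
open scoped Real ComplexConjugate BigOperators

namespace Summit.RiemannHypothesis.RiemannHypothesis.Theorems.WeilFormatC

open Literature.NumberTheory.LFunctions Literature.NumberTheory.LFunctions.Yoshida1992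

variable {a : ℝ}

/-- On the closed window `χ_n(x) = (2a)^{-1/2} e^{πinx/a}`. -/
theorem chi_apply_of_mem (n : ℤ) {x : ℝ} (hx : x ∈ Icc (-a) a) :
    chi a n x = ((1 / Real.sqrt (2 * a) : ℝ) : ℂ) * cexp (π * I * n * x / a) :=
  indicator_of_mem hx _

/-- On the closed window `χ_n = χ_n^{core}`. -/
theorem chi_eq_chiCore_of_mem (n : ℤ) {x : ℝ} (hx : x ∈ Icc (-a) a) : chi a n x = chiCore a n x :=
  indicator_of_mem hx _

/-- Off the closed window `χ_n(x) = 0`. -/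
theorem chi_apply_of_not_mem (n : ℤ) {x : ℝ} (hx : x ∉ Icc (-a) a) : chi a n x = 0 :=
  indicator_of_notMem hx _

/-- `χ_n · φ` is the truncation to `[-a, a]` of `χ_n^{core} · φ`. -/
theorem chi_mul_eq_indicator (n : ℤ) (φ : ℝ → ℂ) :
    (fun x ↦ chi a n x * φ x) = (Icc (-a) a).indicator (fun x ↦ chiCore a n x * φ x) := by
  funext x
  by_cases hx : x ∈ Icc (-a) a
  · rw [indicator_of_mem hx, chi, indicator_of_mem hx]
  · rw [indicator_of_notMem hx, chi_apply_of_not_mem n hx, zero_mul]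

/-- `φ · χ_n` is the truncation to `[-a, a]` of `φ · χ_n^{core}`. -/
theorem mul_chi_eq_indicator (n : ℤ) (φ : ℝ → ℂ) :
    (fun x ↦ φ x * chi a n x) = (Icc (-a) a).indicator (fun x ↦ φ x * chiCore a n x) := by
  funext x
  by_cases hx : x ∈ Icc (-a) a
  · rw [indicator_of_mem hx, chi, indicator_of_mem hx]
  · rw [indicator_of_notMem hx, chi_apply_of_not_mem n hx, mul_zero]

/-- `χ_n^{core}` is continuous. -/
theorem continuous_chiCore (a : ℝ) (n : ℤ) : Continuous (chiCore a n) :=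
  (contDiff_chiCore a n).continuous

/-- `χ_n · φ` is integrable on `ℝ` for continuous `φ`. -/
theorem integrable_chi_mul (n : ℤ) {φ : ℝ → ℂ} (hφ : Continuous φ) :
    Integrable (fun x ↦ chi a n x * φ x) := by
  rw [chi_mul_eq_indicator]
  exact (((continuous_chiCore a n).mul hφ).continuousOn.integrableOn_Icc).integrable_indicator
    measurableSet_Icc

/-- `φ · χ_n` is integrable on `ℝ` for continuous `φ`. -/
theorem integrable_mul_chi (n : ℤ) {φ : ℝ → ℂ} (hφ : Continuous φ) :
    Integrable (fun x ↦ φ x * chi a n x) := by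
  rw [mul_chi_eq_indicator]
  exact ((hφ.mul (continuous_chiCore a n)).continuousOn.integrableOn_Icc).integrable_indicator
    measurableSet_Icc

/-- `∫_ℝ χ_n φ = ∫_{-a}^{a} (2a)^{-1/2} e^{πinx/a} φ(x) dx` (`0 ≤ a`). -/
theorem integral_chi_mul (ha : 0 ≤ a) (n : ℤ) (φ : ℝ → ℂ) :
    ∫ x, chi a n x * φ x =
      ∫ x in (-a)..a, ((1 / Real.sqrt (2 * a) : ℝ) : ℂ) * cexp (π * I * n * x / a) * φ x := by
  rw [chi_mul_eq_indicator, integral_indicator measurableSet_Icc, integral_Icc_eq_integral_Ioc,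
    ← intervalIntegral.integral_of_le (by linarith)]
  rfl

/-- `∫_ℝ φ conj(χ_m) = ∫_{-a}^{a} φ(x) (2a)^{-1/2} e^{-πimx/a} dx` (`0 ≤ a`). -/
theorem integral_mul_conj_chi (ha : 0 ≤ a) (m : ℤ) (φ : ℝ → ℂ) :
    ∫ x, φ x * conj (chi a m x) =
      ∫ x in (-a)..a, φ x * (((1 / Real.sqrt (2 * a) : ℝ) : ℂ) * cexp (-(π * I * m * x / a))) := by
  have h : (fun x ↦ φ x * conj (chi a m x)) =
      (Icc (-a) a).indicator (fun x ↦ φ x * (((1 / Real.sqrt (2 * a) : ℝ) : ℂ) *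
        cexp (-(π * I * m * x / a)))) := by
    funext x
    by_cases hx : x ∈ Icc (-a) a
    · rw [indicator_of_mem hx, chi_apply_of_mem m hx, map_mul, Complex.conj_ofReal, ← Complex.exp_conj]
      congr 3
      simp only [map_div₀, map_mul, Complex.conj_ofReal, Complex.conj_I, map_intCast]
      ring
    · rw [indicator_of_notMem hx, chi_apply_of_not_mem m hx, map_zero, mul_zero]
  rw [h, integral_indicator measurableSet_Icc, integral_Icc_eq_integral_Ioc,
    ← intervalIntegral.integral_of_le (by linarith)]

/-- **Orthonormality of the `χ_n`**: `∫_ℝ χ_n conj(χ_m) = δ_{nm}` (`a > 0`). -/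
theorem integral_chi_mul_conj_chi (ha : 0 < a) (n m : ℤ) :
    ∫ x, chi a n x * conj (chi a m x) = if n = m then 1 else 0 := by
  rw [integral_mul_conj_chi ha.le]
  have hsa : Real.sqrt (2 * a) ≠ 0 := (Real.sqrt_pos.2 (by positivity)).ne'
  have : (fun x : ℝ ↦ chi a n x * (((1 / Real.sqrt (2 * a) : ℝ) : ℂ) * cexp (-(π * I * m * x / a)))) =
      fun x ↦ ((1 / Real.sqrt (2 * a) : ℝ) : ℂ) * (chi a n x * cexp (-(π * I * m * x / a))) := by
    funext x; ring
  rw [this, intervalIntegral.integral_const_mul]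
  change ((1 / Real.sqrt (2 * a) : ℝ) : ℂ) * fourierCoeff a m (chi a n) = _
  rw [fourierCoeff_chi ha]
  by_cases hmn : m = n
  · subst hmn
    simp only [if_true]
    rw [← Complex.ofReal_mul, show (1 / Real.sqrt (2 * a)) * Real.sqrt (2 * a) = 1 by field_simp]
    simp
  · rw [if_neg hmn, if_neg (Ne.symm hmn), mul_zero]


/-! ## Window integrals of exponentials -/

/-- `(-1)^(-n) = (-1)^n` in `ℂ`. -/
theorem neg_one_zpow_neg (n : ℤ) : (-1 : ℂ) ^ (-n) = (-1) ^ n := by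
  rcases Int.even_or_odd n with h | h
  · rw [h.neg_one_zpow, h.neg.neg_one_zpow]
  · rw [h.neg_one_zpow, h.neg.neg_one_zpow]

/-- `e^{πin} = (-1)^n` for `n ∈ ℤ`. -/
theorem cexp_pi_mul_I_mul_int (n : ℤ) : cexp (π * I * n) = (-1) ^ n := by
  rw [show (π * I * n : ℂ) = n * (π * I) by ring, Complex.exp_int_mul, Complex.exp_pi_mul_I]

/-- The frequency factor `πin/a` is `iω_n`, `ω_n = πn/a` real. -/
theorem pi_mul_I_mul_div_eq (a : ℝ) (n : ℤ) : (π * I * n / a : ℂ) = ((π * n / a : ℝ) : ℂ) * I := by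
  push_cast; ring

/-- `∫_{-a}^{a} e^{(πin/a + c)x} dx = (-1)^n (e^{ca} - e^{-ca})/(πin/a + c)` for `πin/a + c ≠ 0`, `a ≠ 0`
(the endpoint values `e^{±πin} = (-1)^n`). -/
theorem integral_window_cexp (ha : a ≠ 0) (n : ℤ) {c : ℂ} (hc : π * I * n / a + c ≠ 0) :
    ∫ x in (-a)..a, cexp ((π * I * n / a + c) * x) =
      (-1) ^ n * (cexp (c * a) - cexp (-(c * a))) / (π * I * n / a + c) := by
  rw [integral_exp_mul_complex hc]
  have ha' : (a : ℂ) ≠ 0 := by exact_mod_cast ha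
  have h1 : cexp ((π * I * n / a + c) * (a : ℝ)) = (-1) ^ n * cexp (c * a) := by
    rw [add_mul, Complex.exp_add, div_mul_cancel₀ _ ha', cexp_pi_mul_I_mul_int]
  have h2 : cexp ((π * I * n / a + c) * ((-a : ℝ) : ℂ)) = (-1) ^ n * cexp (-(c * a)) := by
    rw [Complex.ofReal_neg, mul_neg, add_mul, div_mul_cancel₀ _ ha', neg_add, Complex.exp_add,
      show -(π * I * n : ℂ) = π * I * ((-n : ℤ) : ℂ) by push_cast; ring, cexp_pi_mul_I_mul_int,
      neg_one_zpow_neg]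
  rw [h1, h2]
  ring

/-- `∫_ℝ χ_n(x) e^{cx} dx = (2a)^{-1/2} (-1)^n (e^{ca} - e^{-ca})/(iω_n + c)` for real `c ≠ 0`. -/
theorem integral_chi_mul_cexp (ha : 0 < a) (n : ℤ) {c : ℝ} (hc : c ≠ 0) :
    ∫ x, chi a n x * cexp (c * x) =
      ((1 / Real.sqrt (2 * a) : ℝ) : ℂ) *
        ((-1) ^ n * ((Real.exp (c * a) : ℂ) - (Real.exp (-(c * a)) : ℂ)) / (((π * n / a : ℝ) : ℂ) * I + c)) := by
  have hne : (π * I * n / a : ℂ) + c ≠ 0 := by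
    rw [pi_mul_I_mul_div_eq]
    intro h
    have := congrArg Complex.re h
    simp at this
    exact hc this
  rw [integral_chi_mul ha.le]
  have hfun : (fun x : ℝ ↦ ((1 / Real.sqrt (2 * a) : ℝ) : ℂ) * cexp (π * I * n * x / a) * cexp (c * x)) =
      fun x : ℝ ↦ ((1 / Real.sqrt (2 * a) : ℝ) : ℂ) * cexp ((π * I * n / a + c) * x) := by
    funext x
    rw [mul_assoc, ← Complex.exp_add]
    congr 2
    ring
  rw [hfun, intervalIntegral.integral_const_mul, integral_window_cexp ha.ne' n hne,
    Complex.ofReal_exp, Complex.ofReal_exp, ← pi_mul_I_mul_div_eq]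
  push_cast
  ring_nf

/-! ## Sesquilinear bookkeeping -/

/-- A finite combination of the `χ_n`, evaluated: `(Σ c_n χ_n)(x) = Σ c_n χ_n(x)`. -/
theorem sum_smul_chi_apply (s : Finset ℤ) (c : ℤ → ℂ) (x : ℝ) :
    (∑ n ∈ s, c n • chi a n) x = ∑ n ∈ s, c n * chi a n x := by
  simp only [Finset.sum_apply, Pi.smul_apply, smul_eq_mul]

/-- `‖Σ c_n r_n‖² = Σ_n Σ_m Re(conj c_n · c_m) r_n r_m` for complex `c_n` and REAL `r_n`. -/
theorem norm_sq_sum_mul_ofReal {ι : Type*} (s : Finset ι) (c : ι → ℂ) (r : ι → ℝ) :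
    ‖∑ n ∈ s, c n * (r n : ℂ)‖ ^ 2 = ∑ n ∈ s, ∑ m ∈ s, (conj (c n) * c m).re * (r n * r m) := by
  have h : ∀ z : ℂ, ‖z‖ ^ 2 = (conj z * z).re := fun z ↦ by
    rw [Complex.conj_mul']; norm_cast
  rw [h, map_sum, Finset.sum_mul_sum, Complex.re_sum]
  refine Finset.sum_congr rfl fun n _ ↦ ?_
  rw [Complex.re_sum]
  refine Finset.sum_congr rfl fun m _ ↦ ?_
  rw [map_mul, Complex.conj_ofReal,
    show conj (c n) * (r n : ℂ) * (c m * (r m : ℂ)) = conj (c n) * c m * ((r n * r m : ℝ) : ℂ) by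
      push_cast; ring, Complex.re_mul_ofReal]

/-- `χ_n conj(χ_m)` is the truncation to `[-a, a]` of a continuous function. -/
theorem chi_mul_conj_chi_eq_indicator (n m : ℤ) :
    (fun x ↦ chi a n x * conj (chi a m x)) =
      (Icc (-a) a).indicator (fun x ↦ chiCore a n x * conj (chiCore a m x)) := by
  funext x
  by_cases hx : x ∈ Icc (-a) a
  · rw [indicator_of_mem hx, chi_eq_chiCore_of_mem n hx, chi_eq_chiCore_of_mem m hx]
  · rw [indicator_of_notMem hx, chi_apply_of_not_mem n hx, zero_mul]

/-- `χ_n conj(χ_m)` is integrable on `ℝ`. -/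
theorem integrable_chi_mul_conj_chi (n m : ℤ) :
    Integrable (fun x ↦ chi a n x * conj (chi a m x)) := by
  rw [chi_mul_conj_chi_eq_indicator]
  exact (((continuous_chiCore a n).mul
    (Complex.continuous_conj.comp (continuous_chiCore a m))).continuousOn.integrableOn_Icc).integrable_indicator
      measurableSet_Icc

/-- **`‖Σ c_n χ_n‖₂² = Σ |c_n|²`** (orthonormality of Yoshida's basis, `a > 0`). -/
theorem integral_norm_sq_sum_smul_chi (ha : 0 < a) (s : Finset ℤ) (c : ℤ → ℂ) :
    ∫ x, ‖(∑ n ∈ s, c n • chi a n) x‖ ^ 2 = ∑ n ∈ s, ‖c n‖ ^ 2 := by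
  have h : ∀ z : ℂ, ‖z‖ ^ 2 = (conj z * z).re := fun z ↦ by
    rw [Complex.conj_mul']; norm_cast
  have hpt : ∀ x, ‖(∑ n ∈ s, c n • chi a n) x‖ ^ 2 =
      (∑ n ∈ s, ∑ m ∈ s, conj (c n) * c m * (chi a m x * conj (chi a n x))).re := by
    intro x
    rw [h, sum_smul_chi_apply, map_sum, Finset.sum_mul_sum]
    congr 1
    refine Finset.sum_congr rfl fun n _ ↦ Finset.sum_congr rfl fun m _ ↦ ?_
    rw [map_mul]; ring
  have hint : ∀ n m : ℤ, Integrable fun x ↦ conj (c n) * c m * (chi a m x * conj (chi a n x)) :=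
    fun n m ↦ (integrable_chi_mul_conj_chi m n).const_mul _
  simp_rw [hpt]
  have hInt : Integrable (fun x ↦ ∑ n ∈ s, ∑ m ∈ s, conj (c n) * c m * (chi a m x * conj (chi a n x))) :=
    integrable_finsetSum s fun n _ ↦ integrable_finsetSum s fun m _ ↦ hint n m
  have hre := integral_re hInt
  simp only [RCLike.re_to_complex] at hre
  rw [hre, integral_finsetSum _ fun n _ ↦ integrable_finsetSum _ fun m _ ↦ hint n m, Complex.re_sum]
  refine Finset.sum_congr rfl fun n hn ↦ ?_
  rw [integral_finsetSum _ fun m _ ↦ hint n m]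
  simp_rw [integral_const_mul, integral_chi_mul_conj_chi ha, mul_ite, mul_one, mul_zero]
  rw [Finset.sum_ite_eq' s n, if_pos hn, ← h]

/-- The same in the sesquilinear shape `Σ_n Σ_m Re(conj c_n · c_m) δ_{nm}`. -/
theorem integral_norm_sq_sum_smul_chi' (ha : 0 < a) (s : Finset ℤ) (c : ℤ → ℂ) :
    ∫ x, ‖(∑ n ∈ s, c n • chi a n) x‖ ^ 2 =
      ∑ n ∈ s, ∑ m ∈ s, (conj (c n) * c m).re * (if n = m then 1 else 0) := by
  rw [integral_norm_sq_sum_smul_chi ha]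
  refine Finset.sum_congr rfl fun n hn ↦ ?_
  simp_rw [mul_ite, mul_one, mul_zero]
  rw [Finset.sum_ite_eq s n, if_pos hn, Complex.conj_mul']
  norm_cast

/-- `Σ c_n (r_n i) = (Σ c_n r_n) i`. -/
theorem sum_mul_ofReal_mul_I {ι : Type*} (s : Finset ι) (c : ι → ℂ) (r : ι → ℝ) :
    ∑ n ∈ s, c n * ((r n : ℂ) * I) = (∑ n ∈ s, c n * (r n : ℂ)) * I := by
  rw [Finset.sum_mul]
  exact Finset.sum_congr rfl fun n _ ↦ by ring

/-- `∫_ℝ (Σ c_n χ_n) φ = Σ c_n ∫_ℝ χ_n φ` for continuous `φ`. -/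
theorem integral_sum_smul_chi_mul (s : Finset ℤ) (c : ℤ → ℂ) {φ : ℝ → ℂ} (hφ : Continuous φ) :
    ∫ x, (∑ n ∈ s, c n • chi a n) x * φ x = ∑ n ∈ s, c n * ∫ x, chi a n x * φ x := by
  have hpt : ∀ x, (∑ n ∈ s, c n • chi a n) x * φ x = ∑ n ∈ s, c n * (chi a n x * φ x) := by
    intro x
    rw [sum_smul_chi_apply, Finset.sum_mul]
    refine Finset.sum_congr rfl fun n _ ↦ ?_
    ring
  simp_rw [hpt]
  rw [integral_finsetSum _ fun n _ ↦ (integrable_chi_mul n hφ).const_mul _]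
  simp_rw [integral_const_mul]

end Summit.RiemannHypothesis.RiemannHypothesis.Theorems.WeilFormatC
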